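import Summits.AnomalousDissipation.AnomalousDissipation.Theorems.ImpulseGridGridInjectionIdentity
import Literature.Analysis.FluidPDE.StokesTorusProofs
import Literature.Analysis.FunctionSpaces.TorusFourierCalculus

/-!
# Route ImpulseGrid (AnomalousDissipation) — crux `GridThesis`, line `Sketch`: the AC/DC design, calculus

Stub `stub_acdcDesignCalculus` (W7) of the checked skeleton of crux item stmt-AnomalousDissipation-1770
(`Summit.AnomalousDissipation.AnomalousDissipation.Theses.ImpulseGrid.GridThesis`).

**The explicit AC/DC grid.** With the streamwise character `e₀ = e^{2πi x₀}`
(`UnitAddTorus.mFourier (Pi.single 0 1)`): the slab profile `Φ = 1 + 2θ cos 2πx₀ = 1 + 2θ Re e₀`,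
its sawtooth `Ψ = (θ/π) sin 2πx₀ = (θ/π) Im e₀`, the cellular two-mode Stokes pattern
`G = A [sin 2πm(x₁+x₂) (e₁−e₂) + sin 2πm(x₁−x₂) (e₁+e₂)]` (the sine Stokes modes
`Torus.stokesMode k a false` at the frequencies `k₊ = (0,m,m)`, `k₋ = (0,m,−m)` with the
transversal amplitudes `a₊ = e₁ − e₂`, `a₋ = e₁ + e₂`), and the quadrature pair `C = (Re e₀) G`,
`S = (Im e₀) G`. This file proves the CALCULUS clauses of the design: smoothness; the invariances
(`e_k (x + s eᵢ) = e_k (x)` whenever `kᵢ = 0`); `G₀ ≡ 0`; `div G = 0` (transversality);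
`∂₀Ψ = Φ − 1` (`∂ⱼ e_k = 2πi kⱼ e_k`); `ΔG = −8π²m² G` (`|k₊|² = |k₋|² = 2m²`);
`ΔC = −4π²(2m²+1) C`, `ΔS = −4π²(2m²+1) S` by the product-to-sum formulas
`Re e_l · Im e_k = ½ (Im e_{k+l} + Im e_{k−l})`, `Im e_l · Im e_k = ½ (Re e_{k−l} − Re e_{k+l})`, which
write `C`, `S` as combinations of four Stokes modes at the frequencies `(±1, m, ±m)`, all of squared
length `2m² + 1`; `div C = div S = div (Φ G) = 0` by `GridInjection.isDivFree_smul_of_design`; and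
`(Φ − 1) G = 2θ C`. The INTEGRAL clauses of the design are the sibling stub W8 (not here).

References: Constantin–Foias 1988, Ch. 4 (4.13)–(4.14), (4.33) (Stokes eigenfields on the torus);
Grafakos 2014, Prop. 3.2.6 (derivatives of characters).
-/

noncomputable section

-- `Summit.<Summit>.<Problem>` is the tree's mandated summit-side namespace (CONVENTIONS §2); for this
-- single-conjunct summit the two coincide, so the duplicate is deliberate.
set_option linter.dupNamespace false

open MeasureTheory Set Filter Topology
open scoped InnerProductSpace RealInnerProductSpace

namespace Summit.AnomalousDissipation.AnomalousDissipation.Theorems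

open Literature.Analysis.FluidPDE Literature.Analysis.FluidPDE.Torus
open Literature.Analysis.FunctionSpaces Literature.Analysis.FunctionSpaces.Torus

namespace AcdcDesign

/-! ### Characters on `T³`: shifts, differences, derivatives -/

/-- A character `e_k` is invariant under translations along the `i`-th circle when `kᵢ = 0`:
`e_k (x + s eᵢ) = e_k (x) e_k (s eᵢ) = e_k (x)`. [folklore] -/
theorem mFourier_add_single_of_apply_eq_zero {k : Fin 3 → ℤ} {i : Fin 3} (hk : k i = 0)
    (x : UnitAddTorus (Fin 3)) (s : UnitAddCircle) :
    UnitAddTorus.mFourier k (x + Pi.single i s) = UnitAddTorus.mFourier k x := by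
  rw [mFourier_apply_add]
  suffices h : UnitAddTorus.mFourier k (Pi.single i s) = 1 by rw [h, mul_one]
  simp only [UnitAddTorus.mFourier, ContinuousMap.coe_mk]
  refine Finset.prod_eq_one fun j _ => ?_
  by_cases hj : j = i
  · subst hj
    rw [hk]
    exact fourier_zero
  · rw [Pi.single_eq_of_ne hj]
    exact fourier_eval_zero _

/-- `e_{k-l} = e_k · conj e_l`. [folklore] -/
theorem mFourier_sub_apply (k l : Fin 3 → ℤ) (x : UnitAddTorus (Fin 3)) :
    UnitAddTorus.mFourier (k - l) x =
      UnitAddTorus.mFourier k x * (starRingEnd ℂ) (UnitAddTorus.mFourier l x) := by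
  rw [sub_eq_add_neg, UnitAddTorus.mFourier_add, UnitAddTorus.mFourier_neg]

/-- `x ↦ Re e_l (x)` is smooth. [folklore] -/
theorem isSmooth_re_mFourier (l : Fin 3 → ℤ) :
    IsSmooth (fun x : UnitAddTorus (Fin 3) => (UnitAddTorus.mFourier l x).re) :=
  (isSmooth_mFourier l).comp_clm Complex.reCLM

/-- `x ↦ Im e_l (x)` is smooth. [folklore] -/
theorem isSmooth_im_mFourier (l : Fin 3 → ℤ) :
    IsSmooth (fun x : UnitAddTorus (Fin 3) => (UnitAddTorus.mFourier l x).im) :=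
  (isSmooth_mFourier l).comp_clm Complex.imCLM

/-- `∂ⱼ Im e_l = 2π lⱼ Re e_l` (from `∂ⱼ e_l = 2πi lⱼ e_l`, Grafakos 2014, Prop. 3.2.6). [folklore] -/
theorem partialDeriv_im_mFourier (l : Fin 3 → ℤ) (j : Fin 3) (x : UnitAddTorus (Fin 3)) :
    partialDeriv j (fun y => (UnitAddTorus.mFourier l y).im) x =
      2 * Real.pi * (l j : ℝ) * (UnitAddTorus.mFourier l x).re := by
  have h := partialDeriv_clm_comp (isSmooth_mFourier l) Complex.imCLM j x
  rw [partialDeriv_mFourier] at h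
  have e : (fun y => (UnitAddTorus.mFourier l y).im) =
      (⇑Complex.imCLM ∘ ⇑(UnitAddTorus.mFourier l)) := rfl
  rw [e, h]
  simp

/-- `∂ⱼ (c Im e_l) = c (2π lⱼ Re e_l)`. [folklore] -/
theorem partialDeriv_const_mul_im_mFourier (c : ℝ) (l : Fin 3 → ℤ) (j : Fin 3)
    (x : UnitAddTorus (Fin 3)) :
    partialDeriv j (fun y => c * (UnitAddTorus.mFourier l y).im) x =
      c * (2 * Real.pi * (l j : ℝ) * (UnitAddTorus.mFourier l x).re) := by
  have e : (fun y => c * (UnitAddTorus.mFourier l y).im) =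
      c • (fun y => (UnitAddTorus.mFourier l y).im) := by
    funext y
    simp only [Pi.smul_apply, smul_eq_mul]
  rw [e, partialDeriv_const_smul ((isSmooth_im_mFourier l).isContDiff (by simp)) c j, Pi.smul_apply,
    partialDeriv_im_mFourier, smul_eq_mul]

/-! ### Linear combinations of eigenfields of the Laplacian -/

/-- `Δ(f + g) = Δf + Δg` for smooth fields on `T³`. [folklore] -/
theorem laplacian_add_apply' {f g : UnitAddTorus (Fin 3) → EuclideanSpace ℝ (Fin 3)}
    (hf : IsSmooth f) (hg : IsSmooth g) (x : UnitAddTorus (Fin 3)) :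
    laplacian (fun y => f y + g y) x = laplacian f x + laplacian g x := by
  rw [Torus.laplacian, Torus.laplacian, Torus.laplacian,
    show liftAt (fun y => f y + g y) x = liftAt f x + liftAt g x from rfl]
  exact ((hf.isContDiff (n := 2) (WithTop.coe_le_coe.mpr le_top)).liftAt x).contDiffAt.laplacian_add
    ((hg.isContDiff (n := 2) (WithTop.coe_le_coe.mpr le_top)).liftAt x).contDiffAt

/-- Sums of smooth `Δ`-eigenfields with the same eigenvalue are such. [folklore] -/
theorem eig_add {f g : UnitAddTorus (Fin 3) → EuclideanSpace ℝ (Fin 3)} {lam : ℝ}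
    (hf : IsSmooth f ∧ ∀ x, laplacian f x = -(lam • f x))
    (hg : IsSmooth g ∧ ∀ x, laplacian g x = -(lam • g x)) :
    IsSmooth (fun y => f y + g y) ∧ ∀ x, laplacian (fun y => f y + g y) x = -(lam • (f x + g x)) := by
  refine ⟨hf.1.add hg.1, fun x => ?_⟩
  rw [laplacian_add_apply' hf.1 hg.1 x, hf.2 x, hg.2 x, smul_add, neg_add]

/-- Constant multiples of smooth `Δ`-eigenfields are such. [folklore] -/
theorem eig_smul {f : UnitAddTorus (Fin 3) → EuclideanSpace ℝ (Fin 3)} {lam : ℝ}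
    (hf : IsSmooth f ∧ ∀ x, laplacian f x = -(lam • f x)) (c : ℝ) :
    IsSmooth (fun y => c • f y) ∧ ∀ x, laplacian (fun y => c • f y) x = -(lam • (c • f x)) := by
  refine ⟨hf.1.smul c, fun x => ?_⟩
  rw [laplacian_const_smul hf.1 c x, hf.2 x, smul_neg, smul_comm]

/-- A Stokes mode is a smooth `Δ`-eigenfield with eigenvalue `4π²|k|²`
(`Torus.laplacian_stokesMode`; Constantin–Foias 1988, Ch. 4, (4.36)–(4.37)). [folklore] -/
theorem eig_mode {k : Fin 3 → ℤ} {lam : ℝ} (a : EuclideanSpace ℝ (Fin 3)) (c : Bool)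
    (h : stokesEigenvalue k = lam) :
    IsSmooth (⇑(stokesMode k a c)) ∧
      ∀ x, laplacian (⇑(stokesMode k a c)) x = -(lam • stokesMode k a c x) :=
  ⟨isSmooth_stokesMode k a c, fun x => by rw [laplacian_stokesMode, neg_smul, h]⟩

/-- `λ_k = 4π² (k₀² + k₁² + k₂²)` on `ℤ³`. [folklore] -/
theorem stokesEigenvalue_fin_three (k : Fin 3 → ℤ) :
    stokesEigenvalue k = 4 * Real.pi ^ 2 * ((k 0 : ℝ) ^ 2 + (k 1 : ℝ) ^ 2 + (k 2 : ℝ) ^ 2) := by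
  simp only [stokesEigenvalue, freqNormSq, Fin.sum_univ_three]

/-- `⟪k, a⟫ = k₀ a₀ + k₁ a₁ + k₂ a₂` for the lattice vector `k ∈ ℤ³ ⊂ ℝ³`. [folklore] -/
theorem inner_latticeVec_fin_three (k : Fin 3 → ℤ) (a : EuclideanSpace ℝ (Fin 3)) :
    ⟪latticeVec k, a⟫ = (k 0 : ℝ) * a 0 + (k 1 : ℝ) * a 1 + (k 2 : ℝ) * a 2 := by
  rw [← sum_intCast_mul_eq_inner_latticeVec, Fin.sum_univ_three]

/-! ### Divergence of linear combinations -/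

/-- Sums of smooth divergence-free fields are divergence free. [folklore] -/
theorem isDivFree_add' {f g : UnitAddTorus (Fin 3) → EuclideanSpace ℝ (Fin 3)}
    (hf : IsSmooth f) (hg : IsSmooth g) (hdf : IsDivFree f) (hdg : IsDivFree g) :
    IsDivFree (fun y => f y + g y) := by
  intro x
  have h1 : IsContDiff 1 f := hf.isContDiff (by simp)
  have h2 : IsContDiff 1 g := hg.isContDiff (by simp)
  have ef := hdf x
  have eg := hdg x
  rw [divergence_eq_sum_partialDeriv_apply h1] at ef
  rw [divergence_eq_sum_partialDeriv_apply h2] at eg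
  change divergence (f + g) x = 0
  rw [divergence_eq_sum_partialDeriv_apply (h1.add h2)]
  simp only [partialDeriv_add h1 h2, Pi.add_apply, PiLp.add_apply, Finset.sum_add_distrib, ef, eg,
    add_zero]

/-- Constant multiples of smooth divergence-free fields are divergence free. [folklore] -/
theorem isDivFree_const_smul' {f : UnitAddTorus (Fin 3) → EuclideanSpace ℝ (Fin 3)}
    (hf : IsSmooth f) (hdf : IsDivFree f) (c : ℝ) : IsDivFree (fun y => c • f y) := by
  intro x
  have h1 : IsContDiff 1 f := hf.isContDiff (by simp)
  have ef := hdf x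
  rw [divergence_eq_sum_partialDeriv_apply h1] at ef
  change divergence (c • f) x = 0
  rw [divergence_eq_sum_partialDeriv_apply (h1.smul c)]
  simp only [partialDeriv_const_smul h1, Pi.smul_apply, PiLp.smul_apply, smul_eq_mul,
    ← Finset.mul_sum, ef, mul_zero]

/-! ### Product-to-sum: a character times a two-mode sine pattern -/

/-- `Re e_l · A (Im e_{k₁} a₁ + Im e_{k₂} a₂) = (A/2) Σ± (Im e_{k₁±l} a₁ + Im e_{k₂±l} a₂)`
(`cos · sin` product-to-sum at the level of characters, `e_{k±l} = e_k e_{±l}`). [folklore] -/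
theorem re_mul_design (A : ℝ) (k₁ k₂ l : Fin 3 → ℤ) (a₁ a₂ : EuclideanSpace ℝ (Fin 3))
    (x : UnitAddTorus (Fin 3)) :
    (UnitAddTorus.mFourier l x).re • (A • (stokesMode k₁ a₁ false x + stokesMode k₂ a₂ false x)) =
      (A / 2) • ((stokesMode (k₁ + l) a₁ false x + stokesMode (k₁ - l) a₁ false x) +
        (stokesMode (k₂ + l) a₂ false x + stokesMode (k₂ - l) a₂ false x)) := by
  simp only [stokesMode_apply, UnitAddTorus.mFourier_add, mFourier_sub_apply, Complex.mul_im,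
    Complex.conj_re, Complex.conj_im, Bool.false_eq_true, if_false]
  ext i
  simp only [PiLp.smul_apply, PiLp.add_apply, smul_eq_mul]
  ring

/-- `Im e_l · A (Im e_{k₁} a₁ + Im e_{k₂} a₂) = (A/2) Σᵢ (Re e_{kᵢ-l} aᵢ + Re e_{kᵢ+l} (-aᵢ))`
(`sin · sin` product-to-sum at the level of characters). [folklore] -/
theorem im_mul_design (A : ℝ) (k₁ k₂ l : Fin 3 → ℤ) (a₁ a₂ : EuclideanSpace ℝ (Fin 3))
    (x : UnitAddTorus (Fin 3)) :
    (UnitAddTorus.mFourier l x).im • (A • (stokesMode k₁ a₁ false x + stokesMode k₂ a₂ false x)) =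
      (A / 2) • ((stokesMode (k₁ - l) a₁ true x + stokesMode (k₁ + l) (-a₁) true x) +
        (stokesMode (k₂ - l) a₂ true x + stokesMode (k₂ + l) (-a₂) true x)) := by
  simp only [stokesMode_apply, UnitAddTorus.mFourier_add, mFourier_sub_apply, Complex.mul_re,
    Complex.conj_re, Complex.conj_im, Bool.false_eq_true, if_false, if_true]
  ext i
  simp only [PiLp.smul_apply, PiLp.add_apply, PiLp.neg_apply, smul_eq_mul]
  ring

/-! ### The two-mode pattern `G = A (stokesMode k₁ a₁ false + stokesMode k₂ a₂ false)` -/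

section Design

variable {A lam : ℝ} {k₁ k₂ l : Fin 3 → ℤ} {a₁ a₂ : EuclideanSpace ℝ (Fin 3)}
  {G C : UnitAddTorus (Fin 3) → EuclideanSpace ℝ (Fin 3)}

/-- `G` is smooth with `ΔG = −λG` when both frequencies have `4π²|kᵢ|² = λ`. [folklore] -/
theorem laplacian_design
    (hG : G = fun x => A • (stokesMode k₁ a₁ false x + stokesMode k₂ a₂ false x))
    (h₁ : stokesEigenvalue k₁ = lam) (h₂ : stokesEigenvalue k₂ = lam) :
    IsSmooth G ∧ ∀ x, laplacian G x = -(lam • G x) := by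
  subst hG
  exact eig_smul (eig_add (eig_mode a₁ false h₁) (eig_mode a₂ false h₂)) A

/-- `G` is divergence free when both amplitudes are transversal. [folklore] -/
theorem isDivFree_design
    (hG : G = fun x => A • (stokesMode k₁ a₁ false x + stokesMode k₂ a₂ false x))
    (h₁ : ⟪latticeVec k₁, a₁⟫ = 0) (h₂ : ⟪latticeVec k₂, a₂⟫ = 0) : IsDivFree G := by
  subst hG
  exact isDivFree_const_smul' ((isSmooth_stokesMode k₁ a₁ false).add (isSmooth_stokesMode k₂ a₂ false))
    (isDivFree_add' (isSmooth_stokesMode k₁ a₁ false) (isSmooth_stokesMode k₂ a₂ false)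
      (isDivFree_stokesMode h₁ false) (isDivFree_stokesMode h₂ false)) A

/-- `G` is invariant under translations along the `i`-th circle when `(k₁)ᵢ = (k₂)ᵢ = 0`. [folklore] -/
theorem design_add_single
    (hG : G = fun x => A • (stokesMode k₁ a₁ false x + stokesMode k₂ a₂ false x))
    {i : Fin 3} (hk₁ : k₁ i = 0) (hk₂ : k₂ i = 0) (s : UnitAddCircle) (x : UnitAddTorus (Fin 3)) :
    G (x + Pi.single i s) = G x := by
  subst hG
  simp only [stokesMode_apply, mFourier_add_single_of_apply_eq_zero hk₁,
    mFourier_add_single_of_apply_eq_zero hk₂]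

/-- The `i`-th component of `G` vanishes when `(a₁)ᵢ = (a₂)ᵢ = 0`. [folklore] -/
theorem design_apply_eq_zero
    (hG : G = fun x => A • (stokesMode k₁ a₁ false x + stokesMode k₂ a₂ false x))
    {i : Fin 3} (ha₁ : a₁ i = 0) (ha₂ : a₂ i = 0) (x : UnitAddTorus (Fin 3)) : G x i = 0 := by
  subst hG
  simp [stokesMode_apply, ha₁, ha₂]

/-- **`Δ((Re e_l) G) = −λ' (Re e_l) G`** when the four shifted frequencies `kᵢ ± l` all have
`4π²|kᵢ ± l|² = λ'`: `(Re e_l) G` is `A/2` times the sum of the four sine Stokes modes at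
`kᵢ ± l` (`re_mul_design`). [folklore] -/
theorem laplacian_re_mul_design
    (hG : G = fun x => A • (stokesMode k₁ a₁ false x + stokesMode k₂ a₂ false x))
    (hC : C = fun x => (UnitAddTorus.mFourier l x).re • G x)
    (h₁ : stokesEigenvalue (k₁ + l) = lam) (h₂ : stokesEigenvalue (k₁ - l) = lam)
    (h₃ : stokesEigenvalue (k₂ + l) = lam) (h₄ : stokesEigenvalue (k₂ - l) = lam) :
    IsSmooth C ∧ ∀ x, laplacian C x = -(lam • C x) := by
  have hC4 : C = fun x => (A / 2) • ((stokesMode (k₁ + l) a₁ false x + stokesMode (k₁ - l) a₁ false x) +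
      (stokesMode (k₂ + l) a₂ false x + stokesMode (k₂ - l) a₂ false x)) := by
    rw [hC, hG]
    funext x
    exact re_mul_design A k₁ k₂ l a₁ a₂ x
  rw [hC4]
  exact eig_smul (eig_add (eig_add (eig_mode a₁ false h₁) (eig_mode a₁ false h₂))
    (eig_add (eig_mode a₂ false h₃) (eig_mode a₂ false h₄))) (A / 2)

/-- **`Δ((Im e_l) G) = −λ' (Im e_l) G`** when the four shifted frequencies `kᵢ ± l` all have
`4π²|kᵢ ± l|² = λ'`: `(Im e_l) G` is `A/2` times a signed sum of the four cosine Stokes modes at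
`kᵢ ± l` (`im_mul_design`). [folklore] -/
theorem laplacian_im_mul_design
    (hG : G = fun x => A • (stokesMode k₁ a₁ false x + stokesMode k₂ a₂ false x))
    (hC : C = fun x => (UnitAddTorus.mFourier l x).im • G x)
    (h₁ : stokesEigenvalue (k₁ + l) = lam) (h₂ : stokesEigenvalue (k₁ - l) = lam)
    (h₃ : stokesEigenvalue (k₂ + l) = lam) (h₄ : stokesEigenvalue (k₂ - l) = lam) :
    IsSmooth C ∧ ∀ x, laplacian C x = -(lam • C x) := by
  have hC4 : C = fun x => (A / 2) • ((stokesMode (k₁ - l) a₁ true x + stokesMode (k₁ + l) (-a₁) true x) +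
      (stokesMode (k₂ - l) a₂ true x + stokesMode (k₂ + l) (-a₂) true x)) := by
    rw [hC, hG]
    funext x
    exact im_mul_design A k₁ k₂ l a₁ a₂ x
  rw [hC4]
  exact eig_smul (eig_add (eig_add (eig_mode a₁ true h₂) (eig_mode (-a₁) true h₁))
    (eig_add (eig_mode a₂ true h₄) (eig_mode (-a₂) true h₃))) (A / 2)

end Design

end AcdcDesign

/-- **Stub (W7) of crux `GridThesis`, line `Sketch`: the explicit AC/DC design, calculus clauses.**
For the one-harmonic slab profile `Φ = 1 + 2θ cos 2πx₀`, its zero-mean sawtooth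
`Ψ = (θ/π) sin 2πx₀`, the cellular two-mode Stokes pattern
`G = A[sin 2πm(x₁+x₂)·(e₁−e₂) + sin 2πm(x₁−x₂)·(e₁+e₂)]` and the quadrature pair `C = cos(2πx₀)G`,
`S = sin(2πx₀)G`: smoothness, the invariances, `G₀ = 0`, `div G = 0`, `∂₀Ψ = Φ − 1`,
`Φ•G` smooth and divergence free, `ΔG = −8π²m²G`, `C, S` smooth divergence-free with
`ΔC = −4π²(2m²+1)C`, `ΔS = −4π²(2m²+1)S` (product-to-sum into Stokes modes of frequencies
`(±1, m, ±m)`), and `(Φ − 1)G = 2θC`. Tree: `UnitAddTorus.mFourier`, `Torus.stokesMode`,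
`isSmooth_stokesMode`, `isDivFree_stokesMode`, `laplacian_stokesMode`, `partialDeriv_mFourier`,
`mFourier_apply_add`, `GridInjection.isDivFree_smul_of_design` (Constantin–Foias 1988, Ch. 4,
(4.13)–(4.14), (4.33); Grafakos 2014, Prop. 3.2.6). The hypotheses `1 ≤ m`, `0 < A`, `0 < θ` of
the skeleton are not needed for these clauses. [folklore] -/
theorem stub_acdcDesignCalculus :
    ∀ (m : ℕ) (A θ : ℝ) (Φ Ψ : UnitAddTorus (Fin 3) → ℝ)
      (G C S : UnitAddTorus (Fin 3) → EuclideanSpace ℝ (Fin 3)),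
      Φ = (fun x => 1 + 2 * θ * (UnitAddTorus.mFourier (Pi.single (0 : Fin 3) (1 : ℤ)) x).re) →
      Ψ = (fun x => θ / Real.pi * (UnitAddTorus.mFourier (Pi.single (0 : Fin 3) (1 : ℤ)) x).im) →
      G = (fun x => A • (stokesMode ![(0 : ℤ), (m : ℤ), (m : ℤ)] (EuclideanSpace.single (1 : Fin 3) (1 : ℝ) - EuclideanSpace.single (2 : Fin 3) (1 : ℝ)) false x +
          stokesMode ![(0 : ℤ), (m : ℤ), -(m : ℤ)] (EuclideanSpace.single (1 : Fin 3) (1 : ℝ) + EuclideanSpace.single (2 : Fin 3) (1 : ℝ)) false x)) →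
      C = (fun x => (UnitAddTorus.mFourier (Pi.single (0 : Fin 3) (1 : ℤ)) x).re • G x) → S = (fun x => (UnitAddTorus.mFourier (Pi.single (0 : Fin 3) (1 : ℤ)) x).im • G x) →
      1 ≤ m → 0 < A → 0 < θ →
      IsSmooth Φ ∧ IsSmooth Ψ ∧ IsSmooth G ∧
      (∀ (s : UnitAddCircle) x, Ψ (x + Pi.single (1 : Fin 3) s) = Ψ x ∧ Ψ (x + Pi.single (2 : Fin 3) s) = Ψ x) ∧
      (∀ (s : UnitAddCircle) x, G (x + Pi.single (0 : Fin 3) s) = G x) ∧ (∀ x, G x 0 = 0) ∧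
      IsDivFree G ∧ (∀ x, partialDeriv 0 Ψ x = Φ x - 1) ∧
      IsSmooth (fun x => Φ x • G x) ∧ IsDivFree (fun x => Φ x • G x) ∧
      (∀ x, laplacian G x = -((8 * Real.pi ^ 2 * (m : ℝ) ^ 2) • G x)) ∧
      IsSmooth C ∧ IsSmooth S ∧ IsDivFree C ∧ IsDivFree S ∧
      (∀ x, laplacian C x = -((4 * Real.pi ^ 2 * (2 * (m : ℝ) ^ 2 + 1)) • C x)) ∧
      (∀ x, laplacian S x = -((4 * Real.pi ^ 2 * (2 * (m : ℝ) ^ 2 + 1)) • S x)) ∧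
      (∀ x, (Φ x - 1) • G x = (2 * θ) • C x) := by
  intro m A θ Φ Ψ G C S hΦ hΨ hG hC hS _hm _hA _hθ
  -- the Stokes eigenvalues `4π²|k|²` of the six frequencies `(0, m, ±m)`, `(±1, m, ±m)`
  have eP : stokesEigenvalue ![(0 : ℤ), (m : ℤ), (m : ℤ)] = 8 * Real.pi ^ 2 * (m : ℝ) ^ 2 := by
    rw [AcdcDesign.stokesEigenvalue_fin_three]; simp; ring
  have eM : stokesEigenvalue ![(0 : ℤ), (m : ℤ), -(m : ℤ)] = 8 * Real.pi ^ 2 * (m : ℝ) ^ 2 := by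
    rw [AcdcDesign.stokesEigenvalue_fin_three]; simp; ring
  have e₁ : stokesEigenvalue (![(0 : ℤ), (m : ℤ), (m : ℤ)] + Pi.single (0 : Fin 3) (1 : ℤ)) =
      4 * Real.pi ^ 2 * (2 * (m : ℝ) ^ 2 + 1) := by
    rw [AcdcDesign.stokesEigenvalue_fin_three]; simp; ring
  have e₂ : stokesEigenvalue (![(0 : ℤ), (m : ℤ), (m : ℤ)] - Pi.single (0 : Fin 3) (1 : ℤ)) =
      4 * Real.pi ^ 2 * (2 * (m : ℝ) ^ 2 + 1) := by
    rw [AcdcDesign.stokesEigenvalue_fin_three]; simp; ring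
  have e₃ : stokesEigenvalue (![(0 : ℤ), (m : ℤ), -(m : ℤ)] + Pi.single (0 : Fin 3) (1 : ℤ)) =
      4 * Real.pi ^ 2 * (2 * (m : ℝ) ^ 2 + 1) := by
    rw [AcdcDesign.stokesEigenvalue_fin_three]; simp; ring
  have e₄ : stokesEigenvalue (![(0 : ℤ), (m : ℤ), -(m : ℤ)] - Pi.single (0 : Fin 3) (1 : ℤ)) =
      4 * Real.pi ^ 2 * (2 * (m : ℝ) ^ 2 + 1) := by
    rw [AcdcDesign.stokesEigenvalue_fin_three]; simp; ring
  -- transversality of the two amplitudes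
  have tP : ⟪latticeVec ![(0 : ℤ), (m : ℤ), (m : ℤ)],
      EuclideanSpace.single (1 : Fin 3) (1 : ℝ) - EuclideanSpace.single (2 : Fin 3) (1 : ℝ)⟫ = 0 := by
    rw [AcdcDesign.inner_latticeVec_fin_three]; simp
  have tM : ⟪latticeVec ![(0 : ℤ), (m : ℤ), -(m : ℤ)],
      EuclideanSpace.single (1 : Fin 3) (1 : ℝ) + EuclideanSpace.single (2 : Fin 3) (1 : ℝ)⟫ = 0 := by
    rw [AcdcDesign.inner_latticeVec_fin_three]; simp
  -- the pattern `G`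
  obtain ⟨hGs, hΔG⟩ := AcdcDesign.laplacian_design hG eP eM
  have hGdiv : IsDivFree G := AcdcDesign.isDivFree_design hG tP tM
  have hG0 : ∀ x, G x 0 = 0 := fun x => AcdcDesign.design_apply_eq_zero hG (by simp) (by simp) x
  have hGinv : ∀ (s : UnitAddCircle) (x : UnitAddTorus (Fin 3)), G (x + Pi.single (0 : Fin 3) s) = G x :=
    fun s x => AcdcDesign.design_add_single hG (by simp) (by simp) s x
  -- the quadrature pair
  obtain ⟨hCs, hΔC⟩ := AcdcDesign.laplacian_re_mul_design hG hC e₁ e₂ e₃ e₄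
  obtain ⟨hSs, hΔS⟩ := AcdcDesign.laplacian_im_mul_design hG hS e₁ e₂ e₃ e₄
  -- the streamwise character and the slab profiles
  have hχ : ∀ i : Fin 3, i ≠ 0 → ∀ (s : UnitAddCircle) (x : UnitAddTorus (Fin 3)),
      UnitAddTorus.mFourier (Pi.single (0 : Fin 3) (1 : ℤ)) (x + Pi.single i s) =
        UnitAddTorus.mFourier (Pi.single (0 : Fin 3) (1 : ℤ)) x :=
    fun i hi s x => AcdcDesign.mFourier_add_single_of_apply_eq_zero (Pi.single_eq_of_ne hi _) x s
  have hre := AcdcDesign.isSmooth_re_mFourier (Pi.single (0 : Fin 3) (1 : ℤ))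
  have him := AcdcDesign.isSmooth_im_mFourier (Pi.single (0 : Fin 3) (1 : ℤ))
  have hΦs : IsSmooth Φ := by
    rw [hΦ]
    exact contDiff_const.add (contDiff_const.mul hre)
  have hΨs : IsSmooth Ψ := by
    rw [hΨ]
    exact contDiff_const.mul him
  have hΦinv : ∀ (s : UnitAddCircle) (x : UnitAddTorus (Fin 3)),
      Φ (x + Pi.single (1 : Fin 3) s) = Φ x ∧ Φ (x + Pi.single (2 : Fin 3) s) = Φ x := fun s x => by
    simp only [hΦ, hχ 1 (by decide) s x, hχ 2 (by decide) s x, and_self]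
  have hΨinv : ∀ (s : UnitAddCircle) (x : UnitAddTorus (Fin 3)),
      Ψ (x + Pi.single (1 : Fin 3) s) = Ψ x ∧ Ψ (x + Pi.single (2 : Fin 3) s) = Ψ x := fun s x => by
    simp only [hΨ, hχ 1 (by decide) s x, hχ 2 (by decide) s x, and_self]
  refine ⟨hΦs, hΨs, hGs, hΨinv, hGinv, hG0, hGdiv, ?_, hΦs.smul' hGs,
    GridInjection.isDivFree_smul_of_design hΦs hGs hΦinv hG0 hGdiv, hΔG, hCs, hSs, ?_, ?_, hΔC, hΔS,
    ?_⟩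
  · -- `∂₀Ψ = Φ - 1`
    intro x
    rw [hΨ, hΦ, AcdcDesign.partialDeriv_const_mul_im_mFourier]
    simp only [Pi.single_eq_same, Int.cast_one, mul_one]
    have hπ : Real.pi ≠ 0 := Real.pi_ne_zero
    field_simp
    ring
  · -- `div C = 0`: `Re e₀` is `x₁,x₂`-invariant, `G₀ = 0`, `div G = 0`
    rw [hC]
    exact GridInjection.isDivFree_smul_of_design hre hGs (fun s x =>
      ⟨congrArg Complex.re (hχ 1 (by decide) s x), congrArg Complex.re (hχ 2 (by decide) s x)⟩) hG0 hGdiv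
  · -- `div S = 0`
    rw [hS]
    exact GridInjection.isDivFree_smul_of_design him hGs (fun s x =>
      ⟨congrArg Complex.im (hχ 1 (by decide) s x), congrArg Complex.im (hχ 2 (by decide) s x)⟩) hG0 hGdiv
  · -- `(Φ - 1) G = 2θ C`
    intro x
    rw [hC, hΦ]
    dsimp only
    rw [smul_smul]
    congr 1
    ring

end Summit.AnomalousDissipation.AnomalousDissipation.Theorems

end
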